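/-
Copyright: statement-level skeleton of a published paper (lit-balaban cell, Phase-2 proof seat p13, gen 9). No proof
claims beyond what the kernel checks below.
-/
import Literature.MathematicalPhysics.QuantumFieldTheory.BalabanImbrieJaffe1984to88.BIJ88TraceTerms579

/-!
# `BalabanImbrieJaffe1984to88.BIJ88Expansion577` — T. Bałaban, J. Imbrie, A. Jaffe, *Effective action and cluster
properties of the abelian Higgs model*, Commun. Math. Phys. **114** (1988) 257–315 [BalabanImbrieJaffe1988]: Sect. 5.7,
p. 290, **(5.7.7)**: *"These expansions can be inserted into V_j, yielding V_j = V_j^{(n̄)} + Σ_X V_j(X), (5.7.7) the first term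
containing the expansions to order n̄ in e_j, the second containing the remaining terms. Both terms involve small, bounded
kernels (of order e_j^{1−α} for V^{(n̄)}, of order e_j^{n̄+1−α}e^{−cr(e_k)|X|⁻} for V(X)), alone or applied to D_{u_{k+1}} or D*_{u_{k+1}}."*
— the CALCULUS of *"order-≤ n̄ part + Σ_X localized remainder"* expansions behind this sentence (sums, products with the
truncation at order `n̄`), and the identity (5.7.7) derived from it (file 2a of seat p13 gen 9; the size clause is file 2b
`BIJ88Expansion577Bounds`; file 1a `BIJ88F1Localized290` constructs the expansion of `F_{1,j}`, file 3 `BIJ88WSplit290` inserts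
`V_j` into the propagators).

statement-level skeleton of published theorems with citation tags; proofs where landed; nothing here is a claim about the Yang–Mills mass gap

PDF held: `paper:balaban1988-cmp114-bij-abelian-higgs-effective-action` (journal page = PDF page + 256); pp. 287–290
[PDF 31–34] read as IMAGES (CCITT renders; copies `HOME/lit-balaban-p13/pages/`).

CITATION HEADER (lean-in-tree rule).  Part of the lit-balaban TYPED SKELETON (HOME `run/shared/lean/pub/lit-balaban/`):
WHAT IS REPRODUCED = row **C2.Eq5.7.7-5.7.9** of `HOME/lit-balaban-r16/ROWS-C2-part2.md`, member **(5.7.7)** (status before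
this file: *"(5.7.7) absent / DEF-level"*).  Unit `lit-balaban-p13` (gen 9), owner r16, referee ref-5.  Built BY NAME on gen 8's
`BIJ88TraceTerms579.cubePolymers`, r16's `BIJ88Sect5StatementsPart2.PolymerSys.cardMinus` (`|X|⁻`) and the tree's
`Literature.Probability.LatticeModels.IsRConnected`; nothing restated.

## The print (p. 287 [PDF 31], p. 290 [PDF 34], verbatim) and the typing (model level, READING declared)

(5.6.10) p. 287: *"−Δ^N_{ũ_{k+1}ũ,Ω} + a_jP_j(ũ_{k+1}ũ) = −Δ^N_{ũ_{k+1},Ω} + a_jP_j(ũ_{k+1}) − V_j(Ω), where V_j(Ω) is obtained by inserting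
(5.6.8), (5.6.9) into the left-hand side."*; p. 287: *"The terms in V_j are small (O(e_j^{1−α})), bounded kernels, either alone
or applied to D_{ũ_{k+1}} or D*_{ũ_{k+1}}."*; p. 290: the two expansion displays `F = Σ_{n=1}^{n̄}(order n) + Σ_X F(X)` (files 1a/1b)
and (5.7.7) as quoted in the title.

READING.  A kernel entry of `V_j` is a finite sum of products `c·F·F′` of a bounded local order-0 coefficient `c` (entries
of `D_{u_{k+1}}`, `D*`, `Q_j`, transporters, weights) with one or two of the expanded quantities `F = F_{1,j}(Ã̃_b)`,
`F_{2,j}(·; y, x)` of p. 290 (from `|D_{ũu}φ|²` via (5.6.9) and `|ψ − Q(ũu)φ|²` via (5.6.8)); all factors of one product are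
rooted at a common cube `c₀` (the bond `b`, resp. the block centre `y`).  An EXPANSION of a quantity `v` at the scale `j`
(`GLExp`: `low n` = the coefficient of `e_jⁿ`, `n ≤ n̄`; `act X` = the term localized in the cube set `X`) represents `v` when
`v = Σ_{n ≤ n̄} e_jⁿ·low n + Σ_X act X` (`val`).  *"Inserting the expansions"* into a product is `GLExp.mul`: the Cauchy product
of the low parts TRUNCATED at order `n̄` is the new low part (*"the first term containing the expansions to order n̄ in e_j"*),
and everything else — the orders `n̄+1 … 2n̄` of the Cauchy product (localized on the home cube `{c₀}`), low × localized,
localized × localized (regrouped on `X = Y ∪ Z`) — is the new localized part (*"the second containing the remaining terms"*).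
Sizes: `lowNorm = Σ_n ‖low n‖` (*"bounded kernels"*), `actNorm κ = Σ_X ‖act X‖e^{κ|X|⁻}` (*"of order … e^{−cr(e_k)|X|⁻}"*,
`|X|⁻` = r16's `cardMinus` on gen 8's `cubePolymers`).

## What is kernel-checked here

* §1 `GLExp`, `val`, `add`/`smul`/`one`/`mul` with **`val_add`**, **`val_smul`**, **`val_mul`** (`val(E·F) = val E · val F`:
  the truncation identity `lowVal_mul_add_overflow` — the product of the two order-`≤ n̄` parts = its orders `≤ n̄`
  (`sum_range_delta_eq`) + the overflow orders — and the regrouping of the double `X`-sum by the union, `actVal_mul_actVal`)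
  — inserting expansions into sums and products yields an expansion.
* §2 ROOTED and CONNECTED expansions are stable (`Rooted.mul`, `Conn.mul`): the regions stay connected unions of cubes
  through the home cube.
* §3 the sizes `lowNorm` (`Σ_n ‖low n‖`), `actNorm κ` (`Σ_X ‖act X‖e^{κ|X|⁻}`) — definitions only; every bound is file 2b
  `BIJ88Expansion577Bounds`.
* §4 linear combinations `lsum` with order-0 coefficients (`val_lsum`, `Rooted.lsum`, `Conn.lsum`, `mul_low_zero`).
* §5 **(5.7.7)**: for `V = Σ_k c_k·val E_k·val E′_k` (`vertexSum`), **`eq577`** `V = V^{(n̄)} + Σ_X V(X)` with `V^{(n̄)} :=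
  lowVal` (`vertexLow`) and `V(X) := act X` (`vertexAct`) of `vertexExp := Σ_k c_k • (E_k·E′_k)`; `vertexExp_rooted`,
  `vertexExp_conn` (the `X` are connected unions of cubes through the home cube).  The size clause *"of order e_j^{1−α} for
  V^{(n̄)}, of order e_j^{n̄+1−α}e^{−cr(e_k)|X|⁻} for V(X)"* is file 2b.

HONEST SCOPE.  Model level (kernel ENTRIES as complex numbers; the coefficients `c_k`, the factor expansions and their norms are
INPUTS — file 1a/1b supply them for `F_{1,j}`, `F_{2,j}`); the operators `D`, `Q_j`, `Δ^N` of (5.6.10) are not constructed, and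
*"applied to D_{u_{k+1}} or D*_{u_{k+1}}"* is read as an order-0 coefficient.  (5.7.8)–(5.7.9) and the `W^{(j)}` split are NOT
here (gen 7/8 files; file 3).  Definitions with bodies + theorems; no `Prop` facts; axioms standard.
-/

noncomputable section

open scoped BigOperators
open Finset

namespace Literature.MathematicalPhysics.QuantumFieldTheory.BalabanImbrieJaffe1984to88.BIJ88Expansion577

open Literature.Probability.LatticeModels (IsRConnected)
open BIJ88TraceTerms579 (cubePolymers)
open BIJ88Sect5StatementsPart2 (PolymerSys)

variable {ι : Type}

/-! ## §1 Expansions «order ≤ n̄ part + Σ_X localized part» and their algebra -/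

/-- An expansion of a quantity at the scale `j` in the sense of p. 290: `low n` = the coefficient of `e_jⁿ` in the *"expansion
to order n̄ in e_j"*, `act X` = the term *"defined in X only"* assigned to the region `X` (a set of cubes).
[cite: BalabanImbrieJaffe1988, (5.7.7) p.290] -/
structure GLExp (ι : Type) where
  /-- coefficient of `e_jⁿ` of the order-`≤ n̄` part -/
  low : ℕ → ℂ
  /-- the term localized in the region `X` -/
  act : Finset ι → ℂ

namespace GLExp

/-- the order-`≤ n̄` part `Σ_{n=0}^{n̄} e_jⁿ·low n` (the `V^{(n̄)}` of (5.7.7)). [cite: BalabanImbrieJaffe1988, (5.7.7) p.290] -/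
def lowVal (nbar : ℕ) (ε : ℝ) (E : GLExp ι) : ℂ := ∑ n ∈ range (nbar + 1), (ε : ℂ) ^ n * E.low n

/-- the localized part `Σ_X act X` (the `Σ_X V(X)` of (5.7.7)). [cite: BalabanImbrieJaffe1988, (5.7.7) p.290] -/
def actVal [Fintype ι] (E : GLExp ι) : ℂ := ∑ X, E.act X

/-- the quantity represented: `Σ_{n ≤ n̄} e_jⁿ·low n + Σ_X act X`. [cite: BalabanImbrieJaffe1988, (5.7.7) p.290] -/
def val [Fintype ι] (nbar : ℕ) (ε : ℝ) (E : GLExp ι) : ℂ := E.lowVal nbar ε + E.actVal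

/-- sum of two expansions. [cite: BalabanImbrieJaffe1988, (5.7.7) p.290] -/
def add (E F : GLExp ι) : GLExp ι := ⟨fun n => E.low n + F.low n, fun X => E.act X + F.act X⟩

/-- an order-0 local coefficient times an expansion (*"alone or applied to D_{u_{k+1}} or D*_{u_{k+1}}"*).
[cite: BalabanImbrieJaffe1988, (5.7.7) p.290] -/
def smul (c : ℂ) (E : GLExp ι) : GLExp ι := ⟨fun n => c * E.low n, fun X => c * E.act X⟩

/-- the expansion of the constant `1` (a product with only one expanded factor). [cite: BalabanImbrieJaffe1988, (5.7.7) p.290] -/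
def one : GLExp ι := ⟨fun n => if n = 0 then 1 else 0, fun _ => 0⟩

/-- the coefficient of total order `n` of the product of the two order-`≤ n̄` parts: `Σ_{i+j=n, i,j ≤ n̄} low₁ i·low₂ j`.
[cite: BalabanImbrieJaffe1988, (5.7.7) p.290] -/
def conv (nbar : ℕ) (E F : GLExp ι) (n : ℕ) : ℂ :=
  ∑ i ∈ range (nbar + 1), ∑ j ∈ range (nbar + 1), if i + j = n then E.low i * F.low j else 0

/-- the orders `n̄+1, …, 2n̄` of the product of the low parts — *"remaining terms"*, localized on the home cube.
[cite: BalabanImbrieJaffe1988, (5.7.7) p.290] -/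
def overflow (nbar : ℕ) (ε : ℝ) (E F : GLExp ι) : ℂ :=
  ∑ i ∈ range (nbar + 1), ∑ j ∈ range (nbar + 1), if nbar < i + j then (ε : ℂ) ^ (i + j) * (E.low i * F.low j) else 0

/-- localized × localized, regrouped on the union: `Σ_{Y ∪ Z = X} act₁ Y·act₂ Z`. [cite: BalabanImbrieJaffe1988, (5.7.7) p.290] -/
def pairAct [Fintype ι] [DecidableEq ι] (E F : GLExp ι) (X : Finset ι) : ℂ :=
  ∑ p ∈ ((univ : Finset (Finset ι)) ×ˢ univ).filter (fun p => p.1 ∪ p.2 = X), E.act p.1 * F.act p.2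

/-- **INSERTING THE EXPANSIONS INTO A PRODUCT**: the product expansion — low part = the product of the low parts truncated at
order `n̄`; the localized part at `X` = the overflow orders on the home cube `{c₀}` + low × localized + localized × low +
`Σ_{Y∪Z=X}` localized × localized. [cite: BalabanImbrieJaffe1988, (5.7.7) p.290] -/
def mul [Fintype ι] [DecidableEq ι] (nbar : ℕ) (ε : ℝ) (c₀ : ι) (E F : GLExp ι) : GLExp ι where
  low n := if n ≤ nbar then conv nbar E F n else 0
  act X := (if X = {c₀} then overflow nbar ε E F else 0) + E.lowVal nbar ε * F.act X + E.act X * F.lowVal nbar ε +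
    E.pairAct F X

section Algebra

variable [Fintype ι] (nbar : ℕ) (ε : ℝ)

/-- `val (E + F) = val E + val F`. [cite: BalabanImbrieJaffe1988, (5.7.7) p.290] -/
theorem val_add (E F : GLExp ι) : (E.add F).val nbar ε = E.val nbar ε + F.val nbar ε := by
  simp only [val, lowVal, actVal, add, mul_add, Finset.sum_add_distrib]
  ring

/-- `val (c • E) = c · val E`. [cite: BalabanImbrieJaffe1988, (5.7.7) p.290] -/
theorem val_smul (c : ℂ) (E : GLExp ι) : (E.smul c).val nbar ε = c * E.val nbar ε := by
  simp only [val, lowVal, actVal, smul, mul_add, Finset.mul_sum]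
  exact congrArg₂ (· + ·) (Finset.sum_congr rfl fun n _ => by ring) rfl

/-- `val 1 = 1`. [cite: BalabanImbrieJaffe1988, (5.7.7) p.290] -/
theorem val_one : (one : GLExp ι).val nbar ε = 1 := by
  simp [val, lowVal, actVal, one, Finset.sum_ite_eq']

end Algebra

/-- regrouping a triple sum `Σ_n Σ_i Σ_j [i + j = n]` over `n ≤ N` as `Σ_i Σ_j [i + j ≤ N]` (the orders of the truncated
product). [cite: BalabanImbrieJaffe1988, (5.7.7) p.290] -/
theorem sum_range_delta_eq {M : Type*} [AddCommMonoid M] (N : ℕ) (g : ℕ → ℕ → ℕ → M) :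
    ∑ n ∈ range (N + 1), ∑ i ∈ range (N + 1), ∑ j ∈ range (N + 1), (if i + j = n then g i j n else 0) =
      ∑ i ∈ range (N + 1), ∑ j ∈ range (N + 1), if i + j ≤ N then g i j (i + j) else 0 := by
  rw [Finset.sum_comm]
  refine Finset.sum_congr rfl fun i _ => ?_
  rw [Finset.sum_comm]
  refine Finset.sum_congr rfl fun j _ => ?_
  rw [Finset.sum_ite_eq]
  simp only [Finset.mem_range, Nat.lt_succ_iff]

section Mul

variable [Fintype ι] [DecidableEq ι] (nbar : ℕ) (ε : ℝ) (c₀ : ι)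

/-- inside the order window the low part of the product is `conv`. [cite: BalabanImbrieJaffe1988, (5.7.7) p.290] -/
theorem mul_low_of_le {n : ℕ} (hn : n ≤ nbar) (E F : GLExp ι) : (mul nbar ε c₀ E F).low n = conv nbar E F n := by
  simp only [mul, if_pos hn]

/-- **THE TRUNCATION**: (order-`≤ n̄` part of the product) + (overflow) = (order-`≤ n̄` part of `E`)·(order-`≤ n̄` part of `F`).
[cite: BalabanImbrieJaffe1988, (5.7.7) p.290] -/
theorem lowVal_mul_add_overflow (E F : GLExp ι) :
    (mul nbar ε c₀ E F).lowVal nbar ε + overflow nbar ε E F = E.lowVal nbar ε * F.lowVal nbar ε := by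
  have h1 : (mul nbar ε c₀ E F).lowVal nbar ε =
      ∑ i ∈ range (nbar + 1), ∑ j ∈ range (nbar + 1),
        if i + j ≤ nbar then (ε : ℂ) ^ (i + j) * (E.low i * F.low j) else 0 := by
    unfold lowVal
    rw [← sum_range_delta_eq nbar fun i j n => (ε : ℂ) ^ n * (E.low i * F.low j)]
    refine Finset.sum_congr rfl fun n hn => ?_
    rw [mul_low_of_le nbar ε c₀ (Nat.le_of_lt_succ (Finset.mem_range.mp hn)), conv, Finset.mul_sum]
    refine Finset.sum_congr rfl fun i _ => ?_
    rw [Finset.mul_sum]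
    refine Finset.sum_congr rfl fun j _ => ?_
    split_ifs <;> simp
  have h2 : E.lowVal nbar ε * F.lowVal nbar ε =
      ∑ i ∈ range (nbar + 1), ∑ j ∈ range (nbar + 1), (ε : ℂ) ^ (i + j) * (E.low i * F.low j) := by
    unfold lowVal
    rw [Finset.sum_mul_sum]
    refine Finset.sum_congr rfl fun i _ => Finset.sum_congr rfl fun j _ => ?_
    rw [pow_add]; ring
  rw [h1, h2, overflow, ← Finset.sum_add_distrib]
  refine Finset.sum_congr rfl fun i _ => ?_
  rw [← Finset.sum_add_distrib]
  refine Finset.sum_congr rfl fun j _ => ?_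
  by_cases h : i + j ≤ nbar
  · rw [if_pos h, if_neg (not_lt.mpr h), add_zero]
  · rw [if_neg h, if_pos (not_le.mp h), zero_add]

/-- the double `X`-sum of a product of localized parts, REGROUPED BY THE UNION: `(Σ_Y act₁ Y)(Σ_Z act₂ Z) = Σ_X Σ_{Y∪Z=X} act₁ Y act₂ Z`.
[cite: BalabanImbrieJaffe1988, (5.7.7) p.290] -/
theorem actVal_mul_actVal (E F : GLExp ι) : E.actVal * F.actVal = ∑ X, E.pairAct F X := by
  unfold actVal pairAct
  rw [Finset.sum_mul_sum, ← Finset.sum_product']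
  exact (Finset.sum_fiberwise_of_maps_to (g := fun p : Finset ι × Finset ι => p.1 ∪ p.2)
    (fun _ _ => Finset.mem_univ _) _).symm

/-- the localized part of the product, summed over `X`. [cite: BalabanImbrieJaffe1988, (5.7.7) p.290] -/
theorem actVal_mul (E F : GLExp ι) : (mul nbar ε c₀ E F).actVal =
    overflow nbar ε E F + E.lowVal nbar ε * F.actVal + E.actVal * F.lowVal nbar ε + E.actVal * F.actVal := by
  rw [actVal_mul_actVal]
  unfold actVal
  simp only [mul, Finset.sum_add_distrib, Finset.sum_ite_eq', Finset.mem_univ, if_true, ← Finset.mul_sum,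
    ← Finset.sum_mul]

/-- **`val (E·F) = val E · val F`** — *"These expansions can be inserted into V_j"*: the product of two represented quantities is
represented by the product expansion. [cite: BalabanImbrieJaffe1988, (5.7.7) p.290] -/
theorem val_mul (E F : GLExp ι) : (mul nbar ε c₀ E F).val nbar ε = E.val nbar ε * F.val nbar ε := by
  have h := lowVal_mul_add_overflow nbar ε c₀ E F
  rw [val, actVal_mul, val, val]
  linear_combination h

end Mul

end GLExp

/-! ## §2 Rooted and connected expansions -/

/-- the localized parts live on regions through the home cube `c₀` (the cube of `b`: every `X` of (5.7.5) contains the bonds it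
was associated to). [cite: BalabanImbrieJaffe1988, (5.7.5) p.289] -/
def Rooted (c₀ : ι) (E : GLExp ι) : Prop := ∀ X, E.act X ≠ 0 → c₀ ∈ X

/-- the localized parts live on `R`-connected regions (*"a connected union of r(e_k)-cubes"*, p. 289).
[cite: BalabanImbrieJaffe1988, (5.7.5) p.289] -/
def Conn (R : ι → ι → Prop) (E : GLExp ι) : Prop := ∀ X, E.act X ≠ 0 → IsRConnected R X

/-- two `R`-connected cube sets that meet have an `R`-connected union. [folklore] -/
private theorem isRConnected_union [DecidableEq ι] {R : ι → ι → Prop} {X Y : Finset ι} (hX : IsRConnected R X)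
    (hY : IsRConnected R Y) (hXY : (X ∩ Y).Nonempty) : IsRConnected R (X ∪ Y) := by
  obtain ⟨z, hz⟩ := hXY
  rw [Finset.mem_inter] at hz
  have lift : ∀ {Z : Finset ι}, Z ⊆ X ∪ Y → ∀ {v w : ι},
      Relation.ReflTransGen (fun x y => R x y ∧ x ∈ Z ∧ y ∈ Z) v w →
      Relation.ReflTransGen (fun x y => R x y ∧ x ∈ X ∪ Y ∧ y ∈ X ∪ Y) v w := by
    intro Z hZ v w h
    induction h with
    | refl => exact Relation.ReflTransGen.refl
    | tail _ hbc ih => exact ih.tail ⟨hbc.1, hZ hbc.2.1, hZ hbc.2.2⟩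
  refine ⟨⟨z, Finset.mem_union_left _ hz.1⟩, fun v hv w hw => ?_⟩
  have hvz : Relation.ReflTransGen (fun x y => R x y ∧ x ∈ X ∪ Y ∧ y ∈ X ∪ Y) v z := by
    rcases Finset.mem_union.1 hv with hv | hv
    · exact lift Finset.subset_union_left (hX.2 v hv z hz.1)
    · exact lift Finset.subset_union_right (hY.2 v hv z hz.2)
  have hzw : Relation.ReflTransGen (fun x y => R x y ∧ x ∈ X ∪ Y ∧ y ∈ X ∪ Y) z w := by
    rcases Finset.mem_union.1 hw with hw | hw
    · exact lift Finset.subset_union_left (hX.2 z hz.1 w hw)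
    · exact lift Finset.subset_union_right (hY.2 z hz.2 w hw)
  exact hvz.trans hzw

/-- a singleton is `R`-connected. [folklore] -/
private theorem isRConnected_singleton {R : ι → ι → Prop} (c : ι) : IsRConnected R ({c} : Finset ι) :=
  ⟨⟨c, Finset.mem_singleton_self c⟩, fun v hv w hw => by
    rw [Finset.mem_singleton] at hv hw
    subst hv; subst hw
    exact Relation.ReflTransGen.refl⟩

namespace GLExp

section RootedConn

variable [Fintype ι] [DecidableEq ι] (nbar : ℕ) (ε : ℝ) (c₀ : ι)

/-- a non-zero `Σ_{Y∪Z=X}` term exhibits `Y, Z` with `Y ∪ Z = X`, `act₁ Y ≠ 0`, `act₂ Z ≠ 0`.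
[cite: BalabanImbrieJaffe1988, (5.7.7) p.290] -/
theorem exists_of_pairAct_ne_zero {E F : GLExp ι} {X : Finset ι} (h : E.pairAct F X ≠ 0) :
    ∃ Y Z, Y ∪ Z = X ∧ E.act Y ≠ 0 ∧ F.act Z ≠ 0 := by
  obtain ⟨p, hp, hne⟩ := Finset.exists_ne_zero_of_sum_ne_zero h
  exact ⟨p.1, p.2, (Finset.mem_filter.mp hp).2, left_ne_zero_of_mul hne, right_ne_zero_of_mul hne⟩

/-- **products of rooted expansions are rooted** (the home cube `{c₀}` carries the overflow).
[cite: BalabanImbrieJaffe1988, (5.7.7) p.290] -/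
theorem Rooted.mul {E F : GLExp ι} (hE : Rooted c₀ E) (hF : Rooted c₀ F) : Rooted c₀ (mul nbar ε c₀ E F) := by
  intro X hX
  by_cases hX0 : X = {c₀}
  · rw [hX0]; exact Finset.mem_singleton_self _
  simp only [GLExp.mul, if_neg hX0, zero_add] at hX
  by_contra hc
  have h2 : F.act X = 0 := by_contra fun h => hc (hF X h)
  have h3 : E.act X = 0 := by_contra fun h => hc (hE X h)
  have h4 : E.pairAct F X = 0 := by
    by_contra h
    obtain ⟨Y, Z, hYZ, hY, -⟩ := exists_of_pairAct_ne_zero h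
    exact hc (hYZ ▸ Finset.mem_union_left _ (hE Y hY))
  rw [h2, h3, h4, mul_zero, zero_mul] at hX
  exact hX (by ring)

/-- **products of rooted connected expansions are connected** — the regions of (5.7.7) remain *"connected unions of
r(e_k)-cubes"* (unions of connected sets through the home cube). [cite: BalabanImbrieJaffe1988, (5.7.7) p.290] -/
theorem Conn.mul {R : ι → ι → Prop} {E F : GLExp ι} (hE : Rooted c₀ E) (hF : Rooted c₀ F) (hEc : Conn R E)
    (hFc : Conn R F) : Conn R (mul nbar ε c₀ E F) := by
  intro X hX
  by_cases hX0 : X = {c₀}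
  · rw [hX0]; exact isRConnected_singleton c₀
  simp only [GLExp.mul, if_neg hX0, zero_add] at hX
  by_contra hc
  have h2 : F.act X = 0 := by_contra fun h => hc (hFc X h)
  have h3 : E.act X = 0 := by_contra fun h => hc (hEc X h)
  have h4 : E.pairAct F X = 0 := by
    by_contra h
    obtain ⟨Y, Z, hYZ, hY, hZ⟩ := exists_of_pairAct_ne_zero h
    exact hc (hYZ ▸ isRConnected_union (hEc Y hY) (hFc Z hZ) ⟨c₀, Finset.mem_inter.mpr ⟨hE Y hY, hF Z hZ⟩⟩)
  rw [h2, h3, h4, mul_zero, zero_mul] at hX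
  exact hX (by ring)

end RootedConn

/-- [cite: BalabanImbrieJaffe1988, (5.7.7) p.290] -/
theorem Rooted.one (c₀ : ι) : Rooted c₀ (one : GLExp ι) := fun _ hX => absurd rfl hX

/-- [cite: BalabanImbrieJaffe1988, (5.7.7) p.290] -/
theorem Conn.one (R : ι → ι → Prop) : Conn R (one : GLExp ι) := fun _ hX => absurd rfl hX

/-! ## §3 The sizes of the two parts (bounds: `BIJ88Expansion577Bounds`) -/

/-- size of the order-`≤ n̄` part: `Σ_{n ≤ n̄} ‖low n‖` (*"small, bounded kernels"*). [cite: BalabanImbrieJaffe1988, (5.7.7) p.290] -/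
def lowNorm (nbar : ℕ) (E : GLExp ι) : ℝ := ∑ n ∈ range (nbar + 1), ‖E.low n‖

/-- size of the localized part at the rate `κ`: `Σ_X ‖act X‖·e^{κ|X|⁻}` (`|X|⁻` = r16's `cardMinus` on gen 8's `cubePolymers`;
*"of order … e^{−cr(e_k)|X|⁻}"*). [cite: BalabanImbrieJaffe1988, (5.7.7) p.290] -/
def actNorm [Fintype ι] (κ : ℝ) (E : GLExp ι) : ℝ := ∑ X, ‖E.act X‖ * Real.exp (κ * (cubePolymers ι).cardMinus X)

/-! ## §4 Linear combinations with order-0 coefficients -/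

section LSum

variable {K : Type*} (nbar : ℕ) (ε : ℝ)

/-- a finite linear combination `Σ_k c_k • E_k` of expansions with order-0 local coefficients (componentwise).
[cite: BalabanImbrieJaffe1988, (5.7.7) p.290] -/
def lsum (s : Finset K) (c : K → ℂ) (E : K → GLExp ι) : GLExp ι :=
  ⟨fun n => ∑ k ∈ s, c k * (E k).low n, fun X => ∑ k ∈ s, c k * (E k).act X⟩

/-- `val (Σ_k c_k • E_k) = Σ_k c_k · val E_k`. [cite: BalabanImbrieJaffe1988, (5.7.7) p.290] -/
theorem val_lsum [Fintype ι] (s : Finset K) (c : K → ℂ) (E : K → GLExp ι) :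
    (lsum s c E).val nbar ε = ∑ k ∈ s, c k * (E k).val nbar ε := by
  simp only [val, lowVal, actVal, lsum, Finset.mul_sum, mul_add, Finset.sum_add_distrib]
  congr 1
  · rw [Finset.sum_comm]
    exact Finset.sum_congr rfl fun k _ => Finset.sum_congr rfl fun n _ => by ring
  · exact Finset.sum_comm

/-- [cite: BalabanImbrieJaffe1988, (5.7.7) p.290] -/
theorem Rooted.lsum (c₀ : ι) {s : Finset K} {c : K → ℂ} {E : K → GLExp ι} (hE : ∀ k ∈ s, Rooted c₀ (E k)) :
    Rooted c₀ (lsum s c E) := by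
  intro X hX
  obtain ⟨k, hk, hne⟩ := Finset.exists_ne_zero_of_sum_ne_zero hX
  exact hE k hk X (right_ne_zero_of_mul hne)

/-- [cite: BalabanImbrieJaffe1988, (5.7.7) p.290] -/
theorem Conn.lsum {R : ι → ι → Prop} {s : Finset K} {c : K → ℂ} {E : K → GLExp ι} (hE : ∀ k ∈ s, Conn R (E k)) :
    Conn R (lsum s c E) := by
  intro X hX
  obtain ⟨k, hk, hne⟩ := Finset.exists_ne_zero_of_sum_ne_zero hX
  exact hE k hk X (right_ne_zero_of_mul hne)

/-- an expanded factor of POSITIVE order (`low 0 = 0`) makes the product of positive order.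
[cite: BalabanImbrieJaffe1988, (5.7.7) p.290] -/
theorem mul_low_zero [Fintype ι] [DecidableEq ι] (c₀ : ι) {E : GLExp ι} (hE : E.low 0 = 0) (F : GLExp ι) :
    (mul nbar ε c₀ E F).low 0 = 0 := by
  rw [mul_low_of_le nbar ε c₀ (Nat.zero_le _), conv]
  refine Finset.sum_eq_zero fun i _ => Finset.sum_eq_zero fun j _ => ?_
  split_ifs with h
  · obtain ⟨rfl, -⟩ := Nat.add_eq_zero_iff.mp h
    rw [hE, zero_mul]
  · rfl

end LSum

end GLExp

/-! ## §5 (5.7.7): `V_j = V_j^{(n̄)} + Σ_X V_j(X)` -/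

section Eq577

open GLExp

variable [Fintype ι] [DecidableEq ι] {K : Type*} [Fintype K] (nbar : ℕ) (ε : ℝ) (c₀ : ι)

/-- the kernel entry of `V_j` as obtained *"by inserting (5.6.8), (5.6.9) into the left-hand side"* of (5.6.10): a finite sum of
products `c_k·F_k·F′_k` of an order-0 local coefficient with two expanded factors (`F′_k = 1` for the terms with one factor),
each factor given WITH its expansion `E_k`, `E′_k`. [cite: BalabanImbrieJaffe1988, (5.6.10) p.287, (5.7.7) p.290] -/
def vertexSum (c : K → ℂ) (E E' : K → GLExp ι) : ℂ := ∑ k, c k * ((E k).val nbar ε * (E' k).val nbar ε)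

/-- the expansion of `V_j` obtained by inserting the factor expansions: `Σ_k c_k • (E_k · E′_k)`.
[cite: BalabanImbrieJaffe1988, (5.7.7) p.290] -/
def vertexExp (c : K → ℂ) (E E' : K → GLExp ι) : GLExp ι :=
  GLExp.lsum Finset.univ c fun k => GLExp.mul nbar ε c₀ (E k) (E' k)

/-- `V_j^{(n̄)}` := the order-`≤ n̄` part of the inserted expansion (*"the first term containing the expansions to order n̄ in
e_j"*). [cite: BalabanImbrieJaffe1988, (5.7.7) p.290] -/
def vertexLow (c : K → ℂ) (E E' : K → GLExp ι) : ℂ := (vertexExp nbar ε c₀ c E E').lowVal nbar ε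

/-- `V_j(X)` := the part of the inserted expansion localized in `X` (*"the second containing the remaining terms"*).
[cite: BalabanImbrieJaffe1988, (5.7.7) p.290] -/
def vertexAct (c : K → ℂ) (E E' : K → GLExp ι) (X : Finset ι) : ℂ := (vertexExp nbar ε c₀ c E E').act X

/-- **(5.7.7)** p. 290 [PDF 34], verbatim: *"These expansions can be inserted into V_j, yielding V_j = V_j^{(n̄)} + Σ_X V_j(X),
(5.7.7) the first term containing the expansions to order n̄ in e_j, the second containing the remaining terms."* — PROVED for
the vertex sums `Σ_k c_k·F_k·F′_k` with the factor expansions inserted. [cite: BalabanImbrieJaffe1988, (5.7.7) p.290] -/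
theorem eq577 (c : K → ℂ) (E E' : K → GLExp ι) :
    vertexSum nbar ε c E E' = vertexLow nbar ε c₀ c E E' + ∑ X, vertexAct nbar ε c₀ c E E' X := by
  have h := GLExp.val_lsum nbar ε Finset.univ c fun k => GLExp.mul nbar ε c₀ (E k) (E' k)
  simp only [GLExp.val_mul] at h
  rw [vertexSum, ← h]
  rfl

/-- the regions of `V_j(X)` contain the home cube (they are unions of regions of (5.7.5), all through the cube of `b`).
[cite: BalabanImbrieJaffe1988, (5.7.7) p.290] -/
theorem vertexExp_rooted {c : K → ℂ} {E E' : K → GLExp ι} (hE : ∀ k, Rooted c₀ (E k)) (hE' : ∀ k, Rooted c₀ (E' k)) :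
    Rooted c₀ (vertexExp nbar ε c₀ c E E') :=
  GLExp.Rooted.lsum c₀ fun k _ => GLExp.Rooted.mul nbar ε c₀ (hE k) (hE' k)

/-- the regions of `V_j(X)` are connected unions of cubes (*"X = connected union of r(e_k)-cubes"*).
[cite: BalabanImbrieJaffe1988, (5.7.7) p.290] -/
theorem vertexExp_conn {R : ι → ι → Prop} {c : K → ℂ} {E E' : K → GLExp ι} (hE : ∀ k, Rooted c₀ (E k))
    (hE' : ∀ k, Rooted c₀ (E' k)) (hEc : ∀ k, Conn R (E k)) (hEc' : ∀ k, Conn R (E' k)) :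
    Conn R (vertexExp nbar ε c₀ c E E') :=
  GLExp.Conn.lsum fun k _ => GLExp.Conn.mul nbar ε c₀ (hE k) (hE' k) (hEc k) (hEc' k)

end Eq577

end Literature.MathematicalPhysics.QuantumFieldTheory.BalabanImbrieJaffe1984to88.BIJ88Expansion577

end
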